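import Summits.KontsevichZagierPeriods.KontsevichZagierPeriods.Theorems.SoloBlindTriplication
import HarnessLib

/-!
# Level 9, first kind: triplication collapses the seven `S₃`-orbits to four classes

At level `9` the first-kind exponent triples `{k, l, 9-k-l}` form seven `S₃`-orbits
`{1,1,7}, {1,2,6}, {1,3,5}, {1,4,4}, {2,2,5}, {2,3,4}, {3,3,3}` and FOUR Deligne–Koblitz–Ogus
classes: `{3,3,3}`, `{1,1,7} ∪ {1,3,5}`, `{1,2,6} ∪ {2,2,5}`, `{2,3,4} ∪ {1,4,4}`. Duplication is
silent at odd level (`½ ∉ (1/9)ℤ`); the three merges are exactly the first-kind TRIPLICATION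
chains of `SoloBlindTriplication` (`betaQ_propTo_nine_135/126/234`).

We set up the FIRST-KIND linear sector `V_N^I ⊂ Q` at any level (`firstSpan N`: the `K₀`-span of
`x_π` and of the classes `[β(k/N + m, l/N + n)]`, `k + l < N`), a representative criterion
`firstSpan_le` checked by `decide`, and prove

* `firstSpan_nine_eq`: `V₉^I = K₀ x_π + K₀ β(1/9,1/9) + K₀ β(2/9,2/9) + K₀ β(1/9,4/9) + K₀ β(⅓,⅓)`;
* `kz_levelNineFirst`: if the five periods `π, B(1/9,1/9), B(2/9,2/9), B(1/9,4/9), B(⅓,⅓)` are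
  linearly independent over `K₀ = ℚ̄ ∩ ℝ` (one value per Deligne–Koblitz–Ogus class: the
  Wolfart–Wüstholz theorem), the period map is injective on `V₉^I` — every `K₀`-linear relation
  among first-kind level-9 Beta words and `π` with vanishing period follows from the three rules.

(The second kind at level `9` is NOT treated: its three coincidences `{2,8,8}~{4,6,8}`,
`{3,7,8}~{4,7,7}`, `{5,5,8}~{5,6,7}` are second-kind triplications, for which no one-dimensional
chain exists — see the session notes.)

References: J. Wolfart, G. Wüstholz, Math. Ann. 273 (1985) 1–15; P. Deligne (appendix by
N. Koblitz, A. Ogus), *Valeurs de fonctions L et périodes d'intégrales*, PSPM 33.2 (1979).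
-/

noncomputable section

open Set

namespace Summit.KontsevichZagierPeriods.KontsevichZagierPeriods.Theorems

namespace SoloBlind

open Literature.NumberTheory.Transcendental
open Literature.NumberTheory.Transcendental.KZ

/-! ## The first-kind sector at level `N` -/

/-- First-kind level-`N` pairs: `1 ≤ k, l` and `k + l < N`. -/
def firstPairs (N : ℕ) : Finset (ℕ × ℕ) := (levelPairs N).filter fun kl => kl.1 + kl.2 < N

/-- `R ⊆ firstPairs N` meets every first-kind `S₃`-orbit. -/
def RepresentsFirst (N : ℕ) (R : Finset (ℕ × ℕ)) : Prop :=
  R ⊆ firstPairs N ∧ ∀ q ∈ firstPairs N, ∃ p ∈ R, SameOrbit N p q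

/-- `RepresentsFirst` is decidable. -/
instance (N : ℕ) (R : Finset (ℕ × ℕ)) : Decidable (RepresentsFirst N R) := by
  unfold RepresentsFirst; infer_instance

/-- The first-kind linear sector `V_N^I`: the `K₀`-span of `x_π` and of all
`[β(k/N + m, l/N + n)]`, `1 ≤ k, l`, `k + l < N`, `m, n ∈ ℕ`. -/
def firstSpan (N : ℕ) : Submodule K₀ Q :=
  Submodule.span K₀ (insert xPi {x | ∃ k l m n : ℕ, 1 ≤ k ∧ 1 ≤ l ∧ k + l < N ∧
    x = betaQ ((k : ℚ) / N + m) ((l : ℚ) / N + n)})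

/-- Membership in `firstPairs`. -/
theorem mem_firstPairs {N : ℕ} {k l : ℕ} (hk : 1 ≤ k) (hl : 1 ≤ l) (hkl : k + l < N) :
    (k, l) ∈ firstPairs N := by
  refine Finset.mem_filter.mpr ⟨mem_levelPairs.mpr ⟨⟨hk, by omega⟩, ⟨hl, by omega⟩, by omega⟩, hkl⟩

/-- **Representative criterion.** A submodule containing `x_π` and one Beta class per first-kind
orbit contains `V_N^I`. -/
theorem firstSpan_le {N : ℕ} {R : Finset (ℕ × ℕ)} (hR : RepresentsFirst N R)
    {S : Submodule K₀ Q} (hπ : xPi ∈ S)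
    (hgen : ∀ p ∈ R, betaQ ((p.1 : ℚ) / N) ((p.2 : ℚ) / N) ∈ S) : firstSpan N ≤ S := by
  apply Submodule.span_le.mpr
  rintro x (rfl | ⟨k, l, m, n, hk, hl, hkl, rfl⟩)
  · exact hπ
  · have hq := mem_firstPairs hk hl hkl
    obtain ⟨p, hpR, hpq⟩ := hR.2 (k, l) hq
    have hN : (0 : ℚ) < N := by exact_mod_cast (show 0 < N by omega)
    have hmem : betaQ ((k : ℚ) / N) ((l : ℚ) / N) ∈ S :=
      (propTo_of_sameOrbit (Finset.filter_subset _ _ (hR.1 hpR))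
        (Finset.filter_subset _ _ hq) hpq).mem (hgen p hpR)
    exact betaQ_shift_memSpan (div_pos (by exact_mod_cast hk) hN)
      (div_pos (by exact_mod_cast hl) hN) hmem m n

/-- A first-kind class lies in `V_N^I`. -/
theorem betaQ_mem_firstSpan {N k l : ℕ} (hk : 1 ≤ k) (hl : 1 ≤ l) (hkl : k + l < N) :
    betaQ ((k : ℚ) / N) ((l : ℚ) / N) ∈ firstSpan N := by
  refine Submodule.subset_span (mem_insert_of_mem _ ⟨k, l, 0, 0, hk, hl, hkl, ?_⟩)
  simp

/-- `x_π ∈ V_N^I`. -/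
theorem xPi_mem_firstSpan (N : ℕ) : xPi ∈ firstSpan N := Submodule.subset_span (mem_insert _ _)

/-- **Injectivity criterion on `V_N^I`.** If `V_N^I` lies in the span of finitely many classes
whose periods are linearly independent over `K₀`, the period map is injective on `V_N^I`. -/
theorem kz_first_of_le {N : ℕ} {ι : Type*} [Fintype ι] {g : ι → Q}
    (hle : firstSpan N ≤ Submodule.span K₀ (range g))
    (h : LinearIndependent K₀ fun i => evalQ (g i)) {z : Q} (hz : z ∈ firstSpan N)
    (h0 : evalQ z = 0) : z = 0 := by
  obtain ⟨c, rfl⟩ := (Submodule.mem_span_range_iff_exists_fun K₀).mp (hle hz)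
  have hsum : ∑ i, c i • evalQ (g i) = 0 := by
    rw [map_sum] at h0
    simpa only [evalQ_smul, IntermediateField.smul_def, smul_eq_mul] using h0
  have hc : ∀ i, c i = 0 := Fintype.linearIndependent_iff.mp h c hsum
  simp [hc]

/-! ## Level `9` -/

/-- First-kind orbit representatives at level 9. -/
def reps9 : Finset (ℕ × ℕ) := {(1, 1), (1, 2), (1, 3), (1, 4), (2, 2), (2, 3), (3, 3)}

/-- `reps9` meets all seven first-kind `S₃`-orbits at level 9. -/
theorem representsFirst9 : RepresentsFirst 9 reps9 := by decide

/-- The five level-9 generators `x_π, β(1/9,1/9), β(2/9,2/9), β(1/9,4/9), β(⅓,⅓)`. -/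
def nineGens : Fin 5 → Q :=
  ![xPi, betaQ (1 / 9) (1 / 9), betaQ (2 / 9) (2 / 9), betaQ (1 / 9) (4 / 9), betaQ (1 / 3) (1 / 3)]

/-- The span of the five generators. -/
def nineSpan : Submodule K₀ Q := Submodule.span K₀ (range nineGens)

/-- `β(1/9,1/9) ∈ ⟨nineGens⟩`. -/
theorem n11_mem : betaQ (1 / 9) (1 / 9) ∈ nineSpan := Submodule.subset_span ⟨1, rfl⟩

/-- `β(2/9,2/9) ∈ ⟨nineGens⟩`. -/
theorem n22_mem : betaQ (2 / 9) (2 / 9) ∈ nineSpan := Submodule.subset_span ⟨2, rfl⟩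

/-- `β(1/9,4/9) ∈ ⟨nineGens⟩`. -/
theorem n14_mem : betaQ (1 / 9) (4 / 9) ∈ nineSpan := Submodule.subset_span ⟨3, rfl⟩

/-- `β(1/3,1/3) ∈ ⟨nineGens⟩`. -/
theorem n33_mem : betaQ (1 / 3) (1 / 3) ∈ nineSpan := Submodule.subset_span ⟨4, rfl⟩

/-- `β(5/9,1/3) ∈ ⟨nineGens⟩` — TRIPLICATION (`{1,3,5} ~ {1,1,7}`). -/
theorem n53_mem : betaQ (5 / 9) (1 / 3) ∈ nineSpan := betaQ_propTo_nine_135.mem n11_mem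

/-- `β(1/9,1/3) ∈ ⟨nineGens⟩` (orbit `{1,3,5}`). -/
theorem n13_mem : betaQ (1 / 9) (1 / 3) ∈ nineSpan := by
  have h := propTo_of_sameOrbit (N := 9) (p := (5, 3)) (q := (1, 3)) (by decide) (by decide)
    (by decide)
  norm_num at h
  exact h.mem n53_mem

/-- `β(1/9,2/3) ∈ ⟨nineGens⟩` — TRIPLICATION (`{1,2,6} ~ {2,2,5}`). -/
theorem n16_mem : betaQ (1 / 9) (2 / 3) ∈ nineSpan := betaQ_propTo_nine_126.mem n22_mem

/-- `β(1/9,2/9) ∈ ⟨nineGens⟩` (orbit `{1,2,6}`). -/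
theorem n12_mem : betaQ (1 / 9) (2 / 9) ∈ nineSpan := by
  have h := propTo_of_sameOrbit (N := 9) (p := (1, 6)) (q := (1, 2)) (by decide) (by decide)
    (by decide)
  norm_num at h
  exact h.mem n16_mem

/-- `β(4/9,1/9) ∈ ⟨nineGens⟩` (orbit `{1,4,4}`). -/
theorem n41_mem : betaQ (4 / 9) (1 / 9) ∈ nineSpan := by
  have h := propTo_of_sameOrbit (N := 9) (p := (1, 4)) (q := (4, 1)) (by decide) (by decide)
    (by decide)
  norm_num at h
  exact h.mem n14_mem

/-- `β(2/9,1/3) ∈ ⟨nineGens⟩` — TRIPLICATION (`{2,3,4} ~ {1,4,4}`). -/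
theorem n23_mem : betaQ (2 / 9) (1 / 3) ∈ nineSpan := betaQ_propTo_nine_234.mem n41_mem

/-- **`V₉^I ⊆ ⟨x_π, β(1/9,1/9), β(2/9,2/9), β(1/9,4/9), β(⅓,⅓)⟩`.** -/
theorem firstSpan_nine_le : firstSpan 9 ≤ nineSpan := by
  refine firstSpan_le representsFirst9 (Submodule.subset_span ⟨0, rfl⟩) ?_
  intro p hp
  simp only [reps9, Finset.mem_insert, Finset.mem_singleton] at hp
  rcases hp with rfl | rfl | rfl | rfl | rfl | rfl | rfl
  · norm_num; exact n11_mem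
  · norm_num; exact n12_mem
  · norm_num; exact n13_mem
  · norm_num; exact n14_mem
  · norm_num; exact n22_mem
  · norm_num; exact n23_mem
  · norm_num; exact n33_mem

/-- The five generators lie in `V₉^I`, so `V₉^I` IS their span. -/
theorem firstSpan_nine_eq : firstSpan 9 = nineSpan := by
  refine le_antisymm firstSpan_nine_le (Submodule.span_le.mpr ?_)
  rintro x ⟨i, rfl⟩
  fin_cases i
  · exact xPi_mem_firstSpan 9
  · exact Submodule.subset_span (mem_insert_of_mem _ ⟨1, 1, 0, 0, le_rfl, le_rfl, by norm_num,
      by norm_num [nineGens]⟩)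
  · exact Submodule.subset_span (mem_insert_of_mem _ ⟨2, 2, 0, 0, by norm_num, by norm_num,
      by norm_num, by norm_num [nineGens]⟩)
  · exact Submodule.subset_span (mem_insert_of_mem _ ⟨1, 4, 0, 0, le_rfl, by norm_num,
      by norm_num, by norm_num [nineGens]⟩)
  · exact Submodule.subset_span (mem_insert_of_mem _ ⟨3, 3, 0, 0, by norm_num, by norm_num,
      by norm_num, by norm_num [nineGens]⟩)

/-- The periods of the generators:
`(π, Γ(1/9)²/Γ(2/9), Γ(2/9)²/Γ(4/9), Γ(1/9)Γ(4/9)/Γ(5/9), Γ(⅓)²/Γ(⅔))`. -/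
theorem evalQ_nineGens : (fun i => evalQ (nineGens i)) =
    ![Real.pi, Real.Gamma (1 / 9) * Real.Gamma (1 / 9) / Real.Gamma (2 / 9),
      Real.Gamma (2 / 9) * Real.Gamma (2 / 9) / Real.Gamma (4 / 9),
      Real.Gamma (1 / 9) * Real.Gamma (4 / 9) / Real.Gamma (5 / 9),
      Real.Gamma (1 / 3) * Real.Gamma (1 / 3) / Real.Gamma (2 / 3)] := by
  funext i
  fin_cases i
  · exact evalQ_xPi
  · show evalQ (betaQ (1 / 9) (1 / 9)) = _
    rw [evalQ_betaQ (by norm_num) (by norm_num)]; norm_num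
  · show evalQ (betaQ (2 / 9) (2 / 9)) = _
    rw [evalQ_betaQ (by norm_num) (by norm_num)]; norm_num
  · show evalQ (betaQ (1 / 9) (4 / 9)) = _
    rw [evalQ_betaQ (by norm_num) (by norm_num)]; norm_num
  · show evalQ (betaQ (1 / 3) (1 / 3)) = _
    rw [evalQ_betaQ (by norm_num) (by norm_num)]; norm_num

/-- **The first-kind linear sector at level 9.** If `π, B(1/9,1/9), B(2/9,2/9), B(1/9,4/9),
B(⅓,⅓)` — one value per Deligne–Koblitz–Ogus class — are linearly independent over `K₀ = ℚ̄ ∩ ℝ`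
(Wolfart–Wüstholz), the period map is injective on `V₉^I`: every `K₀`-linear relation among
first-kind level-9 Beta words and `π` with vanishing period is a consequence of the three
Kontsevich–Zagier rules (the proof USES triplication three times). -/
theorem kz_levelNineFirst (h : LinearIndependent K₀ fun i => evalQ (nineGens i)) {z : Q}
    (hz : z ∈ firstSpan 9) (h0 : evalQ z = 0) : z = 0 :=
  kz_first_of_le firstSpan_nine_le h hz h0

/-- The period map is injective on `V₉^I` (same hypothesis). -/
theorem evalQ_injOn_firstSpan_nine (h : LinearIndependent K₀ fun i => evalQ (nineGens i)) :
    InjOn evalQ (firstSpan 9) := fun x hx y hy hxy => sub_eq_zero.mp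
  (kz_levelNineFirst h ((firstSpan 9).sub_mem hx hy) (by rw [map_sub, hxy, sub_self]))

end SoloBlind

end Summit.KontsevichZagierPeriods.KontsevichZagierPeriods.Theorems
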